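import Literature.Analysis.FluidPDE.TorusLinearisedNSShearModes
import Literature.Analysis.FluidPDE.PassiveScalarShearFibreDamping
import HarnessLib

/-!
# Streamwise Fourier support is preserved by the linearised Navier–Stokes flow at a
# streamwise-invariant background

Analysis/FluidPDE proof file (theorems only; no definitions, no named facts), the Fourier-side reading
of `Torus.linearisedNS_streamwise_rotation_invariant` (`TorusLinearisedNSShearModes`): along a jointly
smooth divergence-free background `u` on `[a, b] × 𝕋^d` invariant under all translations along the
`i`-th axis, if two classical linearised solutions `(w₁, q₁)`, `(w₂, q₂)` have data forming ONE
streamwise Fourier mode `l` and its quadrature companion — `w₁(a, x + r eᵢ) = cos(2πlr) w₁(a, x) −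
sin(2πlr) w₂(a, x)`, `w₂(a, x + r eᵢ) = sin(2πlr) w₁(a, x) + cos(2πlr) w₂(a, x)` for all real `r`,
i.e. `w₁ + i w₂ = e^{2πi l xᵢ} Φ(x')` — then at every `t ∈ [a, b]` the Fourier coefficients of every
component of `w₁(t)` and `w₂(t)` vanish off the two streamwise lines `kᵢ = l`, `kᵢ = −l`
(`Torus.linearisedNS_mFourierCoeff_eq_zero_of_streamwise_mode`): the mode-`l` Kelvin–Helmholtz / Orr
response stays in mode `±l` (Drazin 2002 §8.1 (8.11): normal modes `∝ e^{ikx}`; Bedrossian–Coti Zelati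
2017 §1: `P_k` commutes with the linear evolution), so by Parseval the responses to the different
streamwise modes of a comb datum are `L²`-orthogonal. Tool: the tree's
`Torus.mFourierCoeff_eq_zero_of_forall_add_single_eq_fourier_mul` (`PassiveScalarShearFibreDamping`)
applied to `w₁ ± i w₂`, whose axis eigen-relations `g(x + s eᵢ) = e_{±l}(s) g(x)` are the rotation
relations. For the cell `ad-ideate` (K2″ = item 19696, ApproxSol58 = item 19688).

## References

* P. G. Drazin, *Introduction to Hydrodynamic Stability* (2002), §8.1 (8.9)–(8.11). [`Drazin2002`]
* J. Bedrossian, M. Coti Zelati, ARMA 224 (2017), §1 Thm 1.1. [`BedrossianCotiZelati2017`]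
* L. Grafakos, *Classical Fourier Analysis* (2014), Prop. 3.1.2 (5) (translation ↔ modulation).
  [`Grafakos2014`]
-/

noncomputable section

open MeasureTheory Set Filter Function Complex UnitAddTorus
open scoped ContDiff InnerProductSpace RealInnerProductSpace Topology

namespace Literature.Analysis.FluidPDE

open Literature.Analysis.FunctionSpaces

variable {d : Type*} [Fintype d] [DecidableEq d]

omit [Fintype d] [DecidableEq d] in
/-- `cos α + sin α · i = e_l(r)` on the unit circle for `α = 2π l r`. [cite: Grafakos2014, Prop. 3.1.2 (5)] -/
private theorem cos_add_sin_mul_I_eq_fourier (l : ℤ) (r : ℝ) :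
    ((Real.cos (2 * Real.pi * l * r) : ℝ) : ℂ) + ((Real.sin (2 * Real.pi * l * r) : ℝ) : ℂ) * I =
      fourier l ((r : ℝ) : UnitAddCircle) := by
  rw [fourier_coe_apply, Complex.ofReal_cos, Complex.ofReal_sin, ← Complex.exp_mul_I]
  congr 1
  push_cast
  ring

omit [Fintype d] [DecidableEq d] in
/-- `cos α − sin α · i = e_{-l}(r)` for `α = 2π l r`. [cite: Grafakos2014, Prop. 3.1.2 (5)] -/
private theorem cos_sub_sin_mul_I_eq_fourier (l : ℤ) (r : ℝ) :
    ((Real.cos (2 * Real.pi * l * r) : ℝ) : ℂ) - ((Real.sin (2 * Real.pi * l * r) : ℝ) : ℂ) * I =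
      fourier (-l) ((r : ℝ) : UnitAddCircle) := by
  rw [fourier_coe_apply, Complex.ofReal_cos, Complex.ofReal_sin]
  have h : Complex.cos ((2 * Real.pi * l * r : ℝ) : ℂ) - Complex.sin ((2 * Real.pi * l * r : ℝ) : ℂ) * I =
      Complex.exp (-((2 * Real.pi * l * r : ℝ) : ℂ) * I) := by
    rw [Complex.exp_mul_I, Complex.cos_neg, Complex.sin_neg]
    ring
  rw [h]
  congr 1
  push_cast
  ring

/-- **Streamwise Fourier support is preserved.** Along a jointly smooth divergence-free background `u`
on `[a, b] × 𝕋^d` invariant under the translations along the `i`-th axis (`ν ≥ 0`, `a < b`), let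
`(w₁, q₁)`, `(w₂, q₂)` be classical solutions of the linearised Navier–Stokes system whose data form one
streamwise mode `l` with its quadrature companion:
`w₁(a, x + r eᵢ) = cos(2πlr) w₁(a, x) − sin(2πlr) w₂(a, x)` and
`w₂(a, x + r eᵢ) = sin(2πlr) w₁(a, x) + cos(2πlr) w₂(a, x)` for all real `r` and all `x`. Then for
every `t ∈ [a, b]`, every component `j` and every frequency `k` with `kᵢ ≠ l` and `kᵢ ≠ −l`,
`𝓕(w₁(t)ⱼ)(k) = 0` and `𝓕(w₂(t)ⱼ)(k) = 0`. [cite: Drazin2002, §8.1 (8.9)-(8.11) (normal modes e^{ikx} of the linearised problem)] [cite: BedrossianCotiZelati2017, §1 Thm 1.1 (P_k decoupling)] -/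
theorem Torus.linearisedNS_mFourierCoeff_eq_zero_of_streamwise_mode {a b ν : ℝ} (hν : 0 ≤ ν) (hab : a < b)
    {i : d} {u w₁ w₂ : ℝ → UnitAddTorus d → EuclideanSpace ℝ d} {q₁ q₂ : ℝ → UnitAddTorus d → ℝ}
    (hu : Torus.IsSmoothSpaceTimeOn (Icc a b) u) (hudiv : ∀ t ∈ Icc a b, Torus.IsDivFree (u t))
    (hinv : ∀ t ∈ Icc a b, ∀ (s : UnitAddCircle) (x : UnitAddTorus d), u t (x + Pi.single i s) = u t x)
    (hw₁ : Torus.IsSmoothSpaceTimeOn (Icc a b) w₁) (hq₁ : Torus.IsSmoothSpaceTimeOn (Icc a b) q₁)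
    (hwdiv₁ : ∀ t ∈ Icc a b, Torus.IsDivFree (w₁ t))
    (hlin₁ : ∀ t ∈ Icc a b, ∀ x, Torus.timeDerivWithin (Icc a b) w₁ t x + Torus.convect (u t) (w₁ t) x +
      Torus.convect (w₁ t) (u t) x = ν • Torus.laplacian (w₁ t) x - Torus.gradient (q₁ t) x)
    (hw₂ : Torus.IsSmoothSpaceTimeOn (Icc a b) w₂) (hq₂ : Torus.IsSmoothSpaceTimeOn (Icc a b) q₂)
    (hwdiv₂ : ∀ t ∈ Icc a b, Torus.IsDivFree (w₂ t))
    (hlin₂ : ∀ t ∈ Icc a b, ∀ x, Torus.timeDerivWithin (Icc a b) w₂ t x + Torus.convect (u t) (w₂ t) x +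
      Torus.convect (w₂ t) (u t) x = ν • Torus.laplacian (w₂ t) x - Torus.gradient (q₂ t) x)
    (l : ℤ)
    (h₁ : ∀ (r : ℝ) (x : UnitAddTorus d), w₁ a (x + Pi.single i ((r : ℝ) : UnitAddCircle)) =
      Real.cos (2 * Real.pi * l * r) • w₁ a x - Real.sin (2 * Real.pi * l * r) • w₂ a x)
    (h₂ : ∀ (r : ℝ) (x : UnitAddTorus d), w₂ a (x + Pi.single i ((r : ℝ) : UnitAddCircle)) =
      Real.sin (2 * Real.pi * l * r) • w₁ a x + Real.cos (2 * Real.pi * l * r) • w₂ a x)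
    {t : ℝ} (ht : t ∈ Icc a b) (j : d) {k : d → ℤ} (hk : k i ≠ l) (hk' : k i ≠ -l) :
    mFourierCoeff (fun x => ((w₁ t x j : ℝ) : ℂ)) k = 0 ∧ mFourierCoeff (fun x => ((w₂ t x j : ℝ) : ℂ)) k = 0 := by
  -- the rotation relations at time `t`, for every real translation parameter `r`
  have hrot : ∀ (r : ℝ) (x : UnitAddTorus d),
      w₁ t (x + Pi.single i ((r : ℝ) : UnitAddCircle)) =
          Real.cos (2 * Real.pi * l * r) • w₁ t x - Real.sin (2 * Real.pi * l * r) • w₂ t x ∧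
        w₂ t (x + Pi.single i ((r : ℝ) : UnitAddCircle)) =
          Real.sin (2 * Real.pi * l * r) • w₁ t x + Real.cos (2 * Real.pi * l * r) • w₂ t x :=
    fun r x => Torus.linearisedNS_streamwise_rotation_invariant hν hab hu hudiv
      (Pi.single i ((r : ℝ) : UnitAddCircle)) (fun s hs y => hinv s hs _ y) hw₁ hq₁ hwdiv₁ hlin₁ hw₂ hq₂
      hwdiv₂ hlin₂ (2 * Real.pi * l * r) (h₁ r) (h₂ r) ht x
  -- the complex combinations `g± = w₁ⱼ ± i w₂ⱼ` satisfy axis eigen-relations with characters `e_{±l}`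
  set gp : UnitAddTorus d → ℂ := fun x => ((w₁ t x j : ℝ) : ℂ) + ((w₂ t x j : ℝ) : ℂ) * I with hgp
  set gm : UnitAddTorus d → ℂ := fun x => ((w₁ t x j : ℝ) : ℂ) - ((w₂ t x j : ℝ) : ℂ) * I with hgm
  have hrel : ∀ (s : UnitAddCircle) (x : UnitAddTorus d),
      gp (x + Pi.single i s) = fourier l s * gp x ∧ gm (x + Pi.single i s) = fourier (-l) s * gm x := by
    intro s x
    induction s using QuotientAddGroup.induction_on with
    | H r =>
      obtain ⟨e₁, e₂⟩ := hrot r x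
      have c₁ : w₁ t (x + Pi.single i ((r : ℝ) : UnitAddCircle)) j =
          Real.cos (2 * Real.pi * l * r) * w₁ t x j - Real.sin (2 * Real.pi * l * r) * w₂ t x j := by
        rw [e₁]; simp [smul_eq_mul]
      have c₂ : w₂ t (x + Pi.single i ((r : ℝ) : UnitAddCircle)) j =
          Real.sin (2 * Real.pi * l * r) * w₁ t x j + Real.cos (2 * Real.pi * l * r) * w₂ t x j := by
        rw [e₂]; simp [smul_eq_mul]
      refine ⟨?_, ?_⟩
      · simp only [hgp]
        rw [c₁, c₂, ← cos_add_sin_mul_I_eq_fourier]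
        push_cast
        ring_nf
        rw [Complex.I_sq]
        ring
      · simp only [hgm]
        rw [c₁, c₂, ← cos_sub_sin_mul_I_eq_fourier]
        push_cast
        ring_nf
        rw [Complex.I_sq]
        ring
  have hp : mFourierCoeff gp k = 0 :=
    Torus.mFourierCoeff_eq_zero_of_forall_add_single_eq_fourier_mul (fun s x => (hrel s x).1) hk
  have hm : mFourierCoeff gm k = 0 :=
    Torus.mFourierCoeff_eq_zero_of_forall_add_single_eq_fourier_mul (fun s x => (hrel s x).2) hk'
  -- integrability of the pieces (continuous functions on a compact group)
  have hc₁ : Continuous fun x => ((w₁ t x j : ℝ) : ℂ) :=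
    continuous_ofReal.comp (((hw₁.isSmooth_slice ht).apply j).continuous)
  have hc₂ : Continuous fun x => ((w₂ t x j : ℝ) : ℂ) :=
    continuous_ofReal.comp (((hw₂.isSmooth_slice ht).apply j).continuous)
  have hI₁ : Integrable (fun x => ((w₁ t x j : ℝ) : ℂ)) volume := hc₁.integrable_of_hasCompactSupport
    (HasCompactSupport.of_compactSpace _) |>.mono_measure le_rfl
  have hI₂ : Integrable (fun x => ((w₂ t x j : ℝ) : ℂ) * I) volume :=
    ((hc₂.mul continuous_const).integrable_of_hasCompactSupport (HasCompactSupport.of_compactSpace _))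
  have hgpI : mFourierCoeff gp k = mFourierCoeff (fun x => ((w₁ t x j : ℝ) : ℂ)) k +
      mFourierCoeff (fun x => ((w₂ t x j : ℝ) : ℂ) * I) k := by
    simp only [hgp]
    exact Torus.mFourierCoeff_add hI₁ hI₂ k
  have hgmI : mFourierCoeff gm k = mFourierCoeff (fun x => ((w₁ t x j : ℝ) : ℂ)) k -
      mFourierCoeff (fun x => ((w₂ t x j : ℝ) : ℂ) * I) k := by
    have hadd := Torus.mFourierCoeff_add hI₁ hI₂.neg k
    have e1 : gm = (fun x => ((w₁ t x j : ℝ) : ℂ)) + -(fun x => ((w₂ t x j : ℝ) : ℂ) * I) := by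
      funext x; simp [hgm, sub_eq_add_neg]
    rw [e1, hadd,
      show -(fun x => ((w₂ t x j : ℝ) : ℂ) * I) = (-1 : ℂ) • fun x => ((w₂ t x j : ℝ) : ℂ) * I by
        funext x; simp,
      Torus.mFourierCoeff_const_smul, smul_eq_mul]
    ring
  have hIcoef : mFourierCoeff (fun x => ((w₂ t x j : ℝ) : ℂ) * I) k =
      I * mFourierCoeff (fun x => ((w₂ t x j : ℝ) : ℂ)) k := by
    rw [show (fun x => ((w₂ t x j : ℝ) : ℂ) * I) = I • fun x => ((w₂ t x j : ℝ) : ℂ) by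
      funext x; simp [mul_comm], Torus.mFourierCoeff_const_smul, smul_eq_mul]
  rw [hgpI] at hp
  rw [hgmI] at hm
  rw [hIcoef] at hp hm
  constructor
  · linear_combination (hp + hm) / 2
  · have h2 : (2 : ℂ) * I * mFourierCoeff (fun x => ((w₂ t x j : ℝ) : ℂ)) k = 0 := by
      linear_combination hp - hm
    have hI0 : (2 : ℂ) * I ≠ 0 := mul_ne_zero two_ne_zero Complex.I_ne_zero
    exact (mul_eq_zero.1 h2).resolve_left hI0

end Literature.Analysis.FluidPDE

end
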